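import Summits.QuantumAdvantage.QuantumAdvantage.Theorems.FormTableA
import Summits.QuantumAdvantage.QuantumAdvantage.Theorems.NonDisperseBridgeA
import Summits.QuantumAdvantage.QuantumAdvantage.Theorems.InnerDegreeLawsK

set_option linter.dupNamespace false
set_option linter.unusedSectionVars false

/-!
# NonDisperseEndA (lens 4, g29; the NON-DISPERSING END of the (c0) road, kernel) — low-rank pool ⟹ form table ⟹ LAW C ⟹ loss

Blocker `X = AbsorptionDial.NoPerfectPolyOdd` (item 28487); decomp-qadv lens 4, g29.

* `loss_of_kFormTable` — LAW Q generalised: the extra inner register function restricts on the subcube to a function of `K'` linear forms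
  (not just affinely) ⟹ loss once `(n+1)·2p^(k+K')·(2p−1)^m < (2p)^m` (from `InnerDegreeLawsA.loss_on_kForm_subcube`);
* ★ `loss_of_lowRankPool` — registers `g ≠ g₀` are `k`-forms, `g₀ = H(labels, quadVal M b)`; if on the pool `T` the symmetrised matrix is
  `A * B` (inner dimension `r`) off the diagonal outside `Z`, the strategy loses on the subcube `fill ρ T ·` once
  `(n+1)·2p^(k + 2r + 2|Z| + 1)·(2p−1)^m < (2p)^m` (`FormTableA.quadVal_fill` + `quadVal_formTable`);
* ★★ `loss_of_allNonDisperse` — the END: every bipartition of the pool tiny-or-non-dispersing (modulo Bogolyubov–Ruzsa `hBR`) ⟹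
  (`NonDisperseBridgeA.hQ_of_allNonDisperse` ⟹ `InnerDegreeLawsK.offDiag_lowRank_finset` ⟹ `BlockRankA.exists_factor`) ⟹ loss, once
  `(n+1)·2p^(k + 6r₀ + 1)·(2p−1)^m < (2p)^m`.

Together with `ColumnBridgeD.loss_of_Free_explicit` (a dispersing bipartition ⟹ loss) this closes the (c0) dichotomy in the kernel modulo `hBR`.
Supports stmt-QuantumAdvantage-28487 (record; the residual `X` is NOT claimed).
-/

open Finset Module
open Summit.QuantumAdvantage.AdviceFreeQNC0
open Summit.QuantumAdvantage.QuantumAdvantage.Theorems.InnerDegreeDial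
open Summit.QuantumAdvantage.QuantumAdvantage.Theorems.BilinearCubeSum

namespace Summit.QuantumAdvantage.QuantumAdvantage.Theorems.ColumnBridge

variable {p : ℕ} [Fact p.Prime] {n m : ℕ}

/-- **LAW Q with a form table**: the inner function `q g` restricts on the subcube to a function of `K'` linear forms ⟹ loss. -/
theorem loss_of_kFormTable (hp5 : 5 ≤ p) {k K' : ℕ}
    (hcount : (n + 1) * (p ^ (k + K') * 2) * (2 * p - 1) ^ m < (2 * p) ^ m) (c : ℕ)
    (y : Fin (n + 1) → (Fin n → Bool) → Bool) (ρ : Fin n → Bool) (T : Fin m ↪ Fin n)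
    (lam : Fin (n + 1) → Fin k → Fin n → ZMod p) (q : Fin (n + 1) → (Fin n → Bool) → ZMod p)
    (F : Fin (n + 1) → (Fin k → ZMod p) → ZMod p → Bool)
    (hy : ∀ g u, y g u = F g (fun j => ∑ i, if u i = true then lam g j i else 0) (q g u))
    (hq : ∀ g, ∃ (β : Fin K' → Fin m → ZMod p) (G : (Fin K' → ZMod p) → ZMod p),
      ∀ v, q g (fill ρ T v) = G (fun t => ∑ j, if v j = true then β t j else 0)) :
    ∃ v, ringWinU c y (fill ρ T v) = false := by
  classical
  choose β G hβG using hq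
  let α : Fin (n + 1) → Fin k → ZMod p := fun g j => ∑ i ∈ (univ.map T)ᶜ, if ρ i = true then lam g j i else 0
  let lam' : Fin (n + 1) → Fin (k + K') → Fin m → ZMod p := fun g => Fin.append (fun j j' => lam g j (T j')) (β g)
  let F' : Fin (n + 1) → (Fin (k + K') → ZMod p) → Bool :=
    fun g x => F g (fun j => α g j + x (Fin.castAdd K' j)) (G g (fun t => x (Fin.natAdd k t)))
  refine loss_on_kForm_subcube hp5 hcount c y ρ T lam' F' fun g v => ?_
  rw [hy g (fill ρ T v), hβG g v]
  show F g _ _ = F g _ _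
  congr 1
  · funext j
    rw [linForm_fill]
    simp [lam', α, Fin.append_left]
  · congr 1
    funext t
    simp [lam', Fin.append_right]

/-- **LOSS FROM A LOW-RANK POOL (the non-dispersing end, algebraic form).**  Registers `g ≠ g₀` are `k`-forms, `g₀ = H(labels, quadVal M b)`;
on the pool `T` the symmetrised matrix equals `A * B` (inner dimension `r`) off the diagonal outside `Z` ⟹ loss on the subcube. -/
theorem loss_of_lowRankPool (hp5 : 5 ≤ p) {k r : ℕ} (c : ℕ)
    (y : Fin (n + 1) → (Fin n → Bool) → Bool) (g₀ : Fin (n + 1))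
    (lam : Fin (n + 1) → Fin k → Fin n → ZMod p) (F : Fin (n + 1) → (Fin k → ZMod p) → Bool)
    (hF : ∀ g, g ≠ g₀ → ∀ u, y g u = F g (fun j => ∑ i, if u i = true then lam g j i else 0))
    (Λ : Fin k → Fin n → ZMod p) (M : Fin n → Fin n → ZMod p) (b : Fin n → ZMod p)
    (H : (Fin k → ZMod p) → ZMod p → Bool)
    (hy₀ : ∀ u, y g₀ u = H (fun j => ∑ i, if u i = true then Λ j i else 0) (quadVal M b u))
    (ρ : Fin n → Bool) (T : Fin m ↪ Fin n) (Z : Finset (Fin m))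
    (A : Matrix (Fin m) (Fin r) (ZMod p)) (B : Matrix (Fin r) (Fin m) (ZMod p))
    (hR : ∀ i j, i ≠ j → i ∉ Z → j ∉ Z → M (T i) (T j) + M (T j) (T i) = (A * B) i j)
    (hcount : (n + 1) * (p ^ (k + (2 * r + 2 * Z.card + 1)) * 2) * (2 * p - 1) ^ m < (2 * p) ^ m) :
    ∃ v, ringWinU c y (fill ρ T v) = false := by
  classical
  have h2 : (2 : ZMod p) ≠ 0 := by
    intro h
    have h' : ((2 : ℕ) : ZMod p) = 0 := by exact_mod_cast h
    rw [ZMod.natCast_eq_zero_iff] at h'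
    have := Nat.le_of_dvd (by norm_num) h'
    omega
  -- uniform register description
  let lam₁ : Fin (n + 1) → Fin k → Fin n → ZMod p := fun g => if g = g₀ then Λ else lam g
  let F₁ : Fin (n + 1) → (Fin k → ZMod p) → ZMod p → Bool := fun g vals qv => if g = g₀ then H vals qv else F g vals
  refine loss_of_kFormTable hp5 hcount c y ρ T lam₁ (fun _ => quadVal M b) F₁ (fun g u => ?_) (fun g => ?_)
  · by_cases hg : g = g₀
    · subst hg
      simp only [lam₁, F₁, if_true]
      exact hy₀ u
    · simp only [lam₁, F₁, hg, if_false]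
      exact hF g hg u
  · obtain ⟨C, hC⟩ := FormTable.quadVal_fill M b ρ T
    obtain ⟨ℓ, G, hG⟩ := FormTable.quadVal_formTable h2 (fun j j' => M (T j) (T j'))
      (fun j => b (T j) + ∑ i' ∈ (univ.map T)ᶜ, FormTable.ind ρ i' * (M (T j) i' + M i' (T j))) Z A B hR
    refine ⟨ℓ, fun vals => G vals + C, fun v => ?_⟩
    rw [hC v, hG v]

/-- **THE NON-DISPERSING END of the (c0) road (kernel, modulo Bogolyubov–Ruzsa `hBR`).**  Registers `g ≠ g₀` are `k`-forms,
`g₀ = H(labels, quadVal M b)`; a pool `T` of `m` coordinates each of whose bipartitions is tiny or non-dispersing (side-dependent threshold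
`E side`, see `hQ_of_allNonDisperse`) ⟹ the strategy loses on the subcube `fill ρ T ·`, once `(n+1)·2p^(k + 6r₀ + 1)·(2p−1)^m < (2p)^m` with
`r₀ ≥ 8h + ⌊C(1 + L log p)⁴⌋₊`. -/
theorem loss_of_allNonDisperse (hp5 : 5 ≤ p) {k : ℕ} (c : ℕ)
    (y : Fin (n + 1) → (Fin n → Bool) → Bool) (g₀ : Fin (n + 1))
    (lam : Fin (n + 1) → Fin k → Fin n → ZMod p) (F : Fin (n + 1) → (Fin k → ZMod p) → Bool)
    (hF : ∀ g, g ≠ g₀ → ∀ u, y g u = F g (fun j => ∑ i, if u i = true then lam g j i else 0))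
    (Λ : Fin k → Fin n → ZMod p) (M : Fin n → Fin n → ZMod p) (b : Fin n → ZMod p)
    (H : (Fin k → ZMod p) → ZMod p → Bool)
    (hy₀ : ∀ u, y g₀ u = H (fun j => ∑ i, if u i = true then Λ j i else 0) (quadVal M b u))
    (ρ : Fin n → Bool) (T : Fin m ↪ Fin n)
    (C : ℝ) (hC : 0 ≤ C)
    (hBR : ∀ (n : ℕ) (A : Finset (Fin n → ZMod p)) (α : ℝ), 0 < α → α ≤ 1 → α * (p : ℝ) ^ n ≤ A.card →
      ∃ V : Submodule (ZMod p) (Fin n → ZMod p),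
        ((n : ℝ) - finrank (ZMod p) V) ≤ C * (1 + Real.log (1 / α)) ^ 4 ∧
        ∀ v ∈ V, ∃ a₁ ∈ A, ∃ a₂ ∈ A, ∃ a₃ ∈ A, ∃ a₄ ∈ A, v = a₁ + a₂ - a₃ - a₄)
    (w₂ h L r₀ : ℕ) (E : (Fin m → Bool) → ℕ)
    (hr₀ : 8 * h + ⌊C * (1 + L * Real.log p) ^ 4⌋₊ ≤ r₀) (hh : 2 * p ^ 2 * (L * p) ≤ h + 1)
    (hall : ∀ side : Fin m → Bool, Fintype.card (Side₁ side) ≤ r₀ ∨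
      (0 < E side ∧ 2 * (Fintype.card (Side₂ side) * p + 1) ^ w₂ * 4 ^ Fintype.card (Side₁ side) ≤ E side * p ^ L ∧
        E side < (univ.filter fun xx : (Side₁ side → Bool) × (Side₁ side → Bool) =>
          (univ.filter fun j => (rowForm (Cx M T side) xx.1 - rowForm (Cx M T side) xx.2) j ≠ 0).card < w₂).card))
    (hcount : (n + 1) * (p ^ (k + (6 * r₀ + 1)) * 2) * (2 * p - 1) ^ m < (2 * p) ^ m) :
    ∃ v, ringWinU c y (fill ρ T v) = false := by
  classical
  have hp2 : 2 ≤ p := by omega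
  have hQ := hQ_of_allNonDisperse C hC hBR hp2 M T w₂ h L r₀ E hr₀ hh hall
  obtain ⟨Z, R, hZ, hRr, hQR⟩ := offDiag_lowRank_finset (Qpool M T) r₀ hQ
  obtain ⟨A, B, hAB⟩ := BlockRank.exists_factor R
  have hR : ∀ i j, i ≠ j → i ∉ Z → j ∉ Z → M (T i) (T j) + M (T j) (T i) = (A * B) i j := by
    intro i j hij hi hj
    rw [← hAB]
    exact hQR i j hij hi hj
  refine loss_of_lowRankPool hp5 c y g₀ lam F hF Λ M b H hy₀ ρ T Z A B hR ?_
  -- monotonicity of the count in the exponent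
  have hexp : k + (2 * R.rank + 2 * Z.card + 1) ≤ k + (6 * r₀ + 1) := by omega
  have hp0 : 0 < p := by omega
  calc (n + 1) * (p ^ (k + (2 * R.rank + 2 * Z.card + 1)) * 2) * (2 * p - 1) ^ m
      ≤ (n + 1) * (p ^ (k + (6 * r₀ + 1)) * 2) * (2 * p - 1) ^ m :=
        Nat.mul_le_mul_right _ (Nat.mul_le_mul_left _ (Nat.mul_le_mul_right _ (Nat.pow_le_pow_right hp0 hexp)))
    _ < (2 * p) ^ m := hcount

end Summit.QuantumAdvantage.QuantumAdvantage.Theorems.ColumnBridge
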